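import Summits.AtomisticToContinuum.FouriersLaw.Theorems.BondHeatUncertaintySubdiffusiveBondHeatOfDeficitCesaroEW

/-!
# Strategist artifact (crux stmt-AtomisticToContinuum-9120 `SubdiffusiveBondHeat`): the typed decomposition (D1)

`(S) ⟸ OhmicFloor ∧ TransientEW` — the two `N`-uniform pieces of the crux at the bath bond `b = 0`, spelled
VERBATIM over tree vocabulary (the `let K / θ / E` of route `BoundaryEscapeDeficit`), with the glue proved
sorry-free against the LANDED transfer `subdiffusiveBondHeat_of_deficitCesaroEW` (p96625).

* `OhmicFloor`  : `E_N ≤ C₁/N` for `N ≥ N₀` — bounded response seen from the contact (`D_N = (N-1)γE_N`,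
  `BoundaryEscapeDeficit.ResponseIdentity`); barrier `HasBoundedResponse` met head-on; shared in substance with
  items 11071 / 2187 / 12234–12236 (landed bridges `stub_ohmicFloor_of_escapeLaw`, `stub_ohmicFloor_of_tail_crossover`).
* `TransientEW` : `∫₀ᵗ (1 - θ_N(s) - E_N) ds ≤ C₂ √t` on `[1, cN²]` — the Edwards–Wilkinson law of the
  bath-heat TRANSIENT (the `u^{-3/2}` first-return law of the boundary kinetic-temperature autocorrelation).

This file is NOT filed as a route split (see STRATEGY-CENSUS.md §Decomposition: both children are open-problem
calibre with no supplier; filing would only re-seat leads on `HasBoundedResponse` under a new name). It is the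
ready-made glue for a tenure planner who converts the route into a conditional bridge.
-/

noncomputable section

open MeasureTheory Set Filter Topology
open Literature.MathematicalPhysics.KineticTheory.HeatConduction

namespace Summit.AtomisticToContinuum.FouriersLaw.Cruxes.SubdiffusiveBondHeat.Strategist

open Summit.AtomisticToContinuum.FouriersLaw.Theses.BondHeatUncertainty (SubdiffusiveBondHeat)
open Summit.AtomisticToContinuum.FouriersLaw.Theorems.SubdiffusiveBondHeat
  (subdiffusiveBondHeat_of_deficitCesaroEW)

/-- (D1a) Ohmic floor of the escape deficit: `E_N ≤ C₁ / N` for `N ≥ N₀` (verbatim the lead's former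
registered stub `stub_ohmicFloor`; `E_N` = the `let E` of route `BoundaryEscapeDeficit`). -/
def OhmicFloor : Prop :=
  ∀ ω₂ lam β γ : ℝ, 0 < ω₂ → 0 < lam → 0 < β → 0 < γ → ∀ T : ℝ, 0 < T →
    ∃ C₁ : ℝ, ∃ N₀ : ℕ, ∀ N : ℕ, N₀ ≤ N →
      1 - γ / T ^ 2 * (∫ u in Set.Ioi (0 : ℝ),
        if h : 0 < N then
          ∫ z, ((z.2 ⟨0, h⟩) ^ 2 - T) *
              (∫ y, ((y.2 ⟨0, h⟩) ^ 2 - T) ∂((pinnedChain ω₂ lam β γ).transitionKernel N T T u.toNNReal z))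
            ∂((pinnedChain ω₂ lam β γ).gibbsMeasure N T)
        else 0) ≤ C₁ / (N : ℝ)

/-- (D1b) Edwards–Wilkinson law of the bath-heat transient: `∫₀ᵗ (1 - θ_N(s) - E_N) ds ≤ C₂ √t` for
`1 ≤ t ≤ cN²`, `N ≥ N₀` (verbatim the lead's former registered stub `stub_transientEW`). -/
def TransientEW : Prop :=
  ∀ ω₂ lam β γ : ℝ, 0 < ω₂ → 0 < lam → 0 < β → 0 < γ → ∀ T : ℝ, 0 < T →
    ∃ C₂ c : ℝ, 0 < c ∧ ∃ N₀ : ℕ, ∀ N : ℕ, N₀ ≤ N → ∀ t : ℝ, 1 ≤ t → t ≤ c * (N : ℝ) ^ 2 →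
      (∫ s in (0 : ℝ)..t,
        (1 - γ / T ^ 2 * (∫ u in (0 : ℝ)..s,
            if h : 0 < N then
              ∫ z, ((z.2 ⟨0, h⟩) ^ 2 - T) *
                  (∫ y, ((y.2 ⟨0, h⟩) ^ 2 - T)
                    ∂((pinnedChain ω₂ lam β γ).transitionKernel N T T u.toNNReal z))
                ∂((pinnedChain ω₂ lam β γ).gibbsMeasure N T)
            else 0) -
          (1 - γ / T ^ 2 * (∫ u in Set.Ioi (0 : ℝ),
            if h : 0 < N then
              ∫ z, ((z.2 ⟨0, h⟩) ^ 2 - T) *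
                  (∫ y, ((y.2 ⟨0, h⟩) ^ 2 - T)
                    ∂((pinnedChain ω₂ lam β γ).transitionKernel N T T u.toNNReal z))
                ∂((pinnedChain ω₂ lam β γ).gibbsMeasure N T)
            else 0)))) ≤ C₂ * Real.sqrt t

/-- Abstract Cesàro bookkeeping: if `∫₀ᵗ (f - E) ≤ C₂ √t`, `E ≤ C₁ / N`, `1 ≤ t ≤ c N²`, then
`∫₀ᵗ f ≤ (max C₂ 0 + max C₁ 0 · √c) √t` (junk-safe: a non-integrable `f` makes the left side `0`). -/
theorem cesaro_of_floor_transient {f : ℝ → ℝ} {E C₁ C₂ c t : ℝ} {N : ℕ} (hN : 0 < N) (hc : 0 < c)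
    (ht : 1 ≤ t) (htc : t ≤ c * (N : ℝ) ^ 2) (hfloor : E ≤ C₁ / (N : ℝ))
    (htrans : (∫ s in (0 : ℝ)..t, (f s - E)) ≤ C₂ * Real.sqrt t) :
    (∫ s in (0 : ℝ)..t, f s) ≤ (max C₂ 0 + max C₁ 0 * Real.sqrt c) * Real.sqrt t := by
  have ht0 : 0 ≤ t := le_trans zero_le_one ht
  have hNr : (0 : ℝ) < N := by exact_mod_cast hN
  have hsqrt0 : 0 ≤ Real.sqrt t := Real.sqrt_nonneg _
  have hsqc0 : 0 ≤ Real.sqrt c := Real.sqrt_nonneg _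
  have hwin : t / (N : ℝ) ≤ Real.sqrt c * Real.sqrt t := by
    have h1 : Real.sqrt t ≤ Real.sqrt c * (N : ℝ) := by
      calc Real.sqrt t ≤ Real.sqrt (c * (N : ℝ) ^ 2) := Real.sqrt_le_sqrt htc
        _ = Real.sqrt c * (N : ℝ) := by rw [Real.sqrt_mul hc.le, Real.sqrt_sq hNr.le]
    rw [div_le_iff₀ hNr]
    calc t = Real.sqrt t * Real.sqrt t := (Real.mul_self_sqrt ht0).symm
      _ ≤ Real.sqrt t * (Real.sqrt c * (N : ℝ)) := mul_le_mul_of_nonneg_left h1 hsqrt0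
      _ = Real.sqrt c * Real.sqrt t * (N : ℝ) := by ring
  have htarget0 : 0 ≤ (max C₂ 0 + max C₁ 0 * Real.sqrt c) * Real.sqrt t := by positivity
  by_cases hf : IntervalIntegrable f volume 0 t
  · have hsplit : (∫ s in (0 : ℝ)..t, f s) = (∫ s in (0 : ℝ)..t, (f s - E)) + t * E := by
      rw [intervalIntegral.integral_sub hf intervalIntegrable_const, intervalIntegral.integral_const,
        sub_zero, smul_eq_mul]
      ring
    have hfl : t * E ≤ t * (C₁ / (N : ℝ)) := mul_le_mul_of_nonneg_left hfloor ht0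
    have hfl' : t * (C₁ / (N : ℝ)) ≤ max C₁ 0 * (Real.sqrt c * Real.sqrt t) := by
      calc t * (C₁ / (N : ℝ)) = C₁ * (t / (N : ℝ)) := by ring
        _ ≤ max C₁ 0 * (t / (N : ℝ)) :=
            mul_le_mul_of_nonneg_right (le_max_left _ _) (div_nonneg ht0 hNr.le)
        _ ≤ max C₁ 0 * (Real.sqrt c * Real.sqrt t) := mul_le_mul_of_nonneg_left hwin (le_max_right _ _)
    have htr : (∫ s in (0 : ℝ)..t, (f s - E)) ≤ max C₂ 0 * Real.sqrt t :=
      htrans.trans (mul_le_mul_of_nonneg_right (le_max_left _ _) hsqrt0)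
    rw [hsplit]
    calc (∫ s in (0 : ℝ)..t, (f s - E)) + t * E
        ≤ max C₂ 0 * Real.sqrt t + max C₁ 0 * (Real.sqrt c * Real.sqrt t) := by linarith
      _ = (max C₂ 0 + max C₁ 0 * Real.sqrt c) * Real.sqrt t := by ring
  · rw [intervalIntegral.integral_undef hf]
    exact htarget0

/-- **(D1) glue, kernel-checked against the landed transfer.** `OhmicFloor → TransientEW → SubdiffusiveBondHeat`:
Cesàro bookkeeping `∫₀ᵗ(1-θ_N) = ∫₀ᵗ(1-θ_N-E_N) + tE_N ≤ (max C₂ 0 + max C₁ 0 √c)√t` on the window, then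
`subdiffusiveBondHeat_of_deficitCesaroEW` (p96625: bath-bond reduction + kernel detailed balance + statics). -/
theorem subdiffusiveBondHeat_of_ohmicFloor_transientEW : OhmicFloor → TransientEW → SubdiffusiveBondHeat := by
  intro hO hT
  refine subdiffusiveBondHeat_of_deficitCesaroEW fun ω₂ lam β γ hω hl hβ hγ T hT' => ?_
  obtain ⟨C₁, N₁, hC₁⟩ := hO ω₂ lam β γ hω hl hβ hγ T hT'
  obtain ⟨C₂, c, hc, N₂, hC₂⟩ := hT ω₂ lam β γ hω hl hβ hγ T hT'
  refine ⟨max C₂ 0 + max C₁ 0 * Real.sqrt c, c, hc, max (max N₁ N₂) 1, fun N hN t ht htc => ?_⟩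
  have hN₁ : N₁ ≤ N := le_trans ((le_max_left _ _).trans (le_max_left _ _)) hN
  have hN₂ : N₂ ≤ N := le_trans ((le_max_right _ _).trans (le_max_left _ _)) hN
  have hN0 : 0 < N := lt_of_lt_of_le Nat.one_pos (le_trans (le_max_right _ _) hN)
  exact cesaro_of_floor_transient hN0 hc ht htc (hC₁ N hN₁) (hC₂ N hN₂ t ht htc)

end Summit.AtomisticToContinuum.FouriersLaw.Cruxes.SubdiffusiveBondHeat.Strategist

end
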